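import Mathlib.LinearAlgebra.Span.Basic
import HarnessLib

/-!
# Route ByReductionTypeAtTwo, crux `OrdKatoHalfAtTwoIso` (stmt-BirchSwinnertonDyer-19573): the HALF-CLASS DESCENT in the kernel —
# the abstract core of crux-triage Theorem E / F (F1) («on a rectangular lattice every corestricted Kato class is `2`-divisible;
# a `σ`-invariant class `z` descends to a canonical `y′` with `Cor z = 2y′`»), pure linear algebra (theorems only)

Seat `cruxlead-stmt-BirchSwinnertonDyer-19573-w2` GEN 4 (prover WIDTH under the LEAD `cruxlead-19573` g6; HOME `run/shared/lean/pub/bsd-2adic/`;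
`--supports` stmt-BirchSwinnertonDyer-23921). HONEST FRAMING (cell bsd-2adic): BSD is not proved by any of this; nothing about elliptic curves is
asserted here — this file is the ABSTRACT descent algebra behind the half classes that the typed reading `HasColemanHalfClassPackageAtTwo`
(p700838) names on the two `0 < Δ` cells of the crux (lead g6's P⁺ on [`ρ̄₂` onto ∧ `0 < Δ`]; B7′'s Col½-opt on [`ρ̄₂` not onto], where every
`C₃` curve and every open reducible class is rectangular). Crux-triage r1 seat 2 (GEN 33/34, `Cruxes/OrdKatoHalfAtTwoIso/TRIAGE-r1-2.md` §B,
Theorems E/F; kernel evidence #48 `HalfClassDescent.lean` on stmt-19573, «positive helper — a prover lands it»; typing ask s76) isolated it; this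
is an independent kernel transcription (the evidence file is not readable from this seat), landed so that the arithmetic instance
(`M = 𝐇¹(T₂W)` over `K_∞ = ℚ(ζ_{2^∞}) = ℚ_∞(i)`, `N = M⁺ = 𝐇¹_Iw(ℚ_∞, T₂W)`, `σ = σ_{−1}`, `res`, `Cor`; s76's `IwasawaH1PairData`) has its algebra ready.

THE DATUM (explicit hypotheses, no structure): a commutative ring `R` (`Λ_U`), `R`-modules `M` (upstairs) and `N` (downstairs), `R`-linear
`σ : M → M`, `res : N → M`, `cor : M → N` with: `res` injective, `range res = M^σ` (inflation–restriction with `T^{G_{K_∞}} = 0`: step T14 of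
the tree's `Kato2004/…FineSelmerAtTwoSharp` readings), `res ∘ cor = 1 + σ`, and `M` without `2`-torsion (`𝐇¹` torsion-free, Kato 12.4 (2)).
No `σ² = 1` is needed.

* §1 `cor_res_eq_two_smul` — `cor (res y) = 2y`; `sigma_eq_self_of_two_smul` — `M^σ` is `2`-saturated.
* §2 **`exists_cor_eq_two_smul_of_add_sigma_eq_two_smul`** (Theorem E, abstract core) — if `m + σ m = 2w` then `cor m ∈ 2N`;
  **`existsUnique_res_eq_of_sigma_eq`** + **`cor_eq_two_smul_of_res_eq`** (Theorem F (F1), abstract core) — a `σ`-invariant class `z`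
  descends to a UNIQUE `y′` and `cor z = 2y′` (the canonical half class).
* §3 the Kato-span form: for `ζ : T →+ M` (`γ ↦ z̃_γ`) intertwining a map `ι` of the lattice `T` with `σ` (Kato 12.5 (1): `σ_{−1} z̃_γ = z̃_{ιγ}`)
  on a RECTANGULAR lattice (`γ + ιγ ∈ 2T` for all `γ`, i.e. `T = T⁺ ⊕ T⁻`, `0 < Δ`): every element of the `R`-span of the classes `z̃_γ` has
  `2`-divisible corestriction (`exists_cor_eq_two_smul_of_mem_span_of_rectangular`); the rhombic shape (`Δ < 0`) is NOT claimed.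

What this is NOT: no arithmetic (no Galois cohomology is instantiated; the carrier of s76 is a typing task); no reading is discharged; the
crux, 24097 and 23921 stay OPEN.

References: K. Kato, Astérisque 295 (2004) Thm. 12.4 (2), Thm. 12.5 (1), Thm. 12.6, §13.9 [Kato2004Asterisque]; J. Neukirch, A. Schmidt,
K. Wingberg, *Cohomology of Number Fields*, (1.6.7) inflation–restriction, (1.5.7) cor∘res [NeukirchSchmidtWingberg2008]; crux-triage r1-2 GEN 33 Thm E/F, F-27a.
-/

set_option autoImplicit false
set_option linter.dupNamespace false

namespace Summit.BirchSwinnertonDyer.BirchSwinnertonDyer.Theorems.SteinbergFibreAtTwo.HalfClassDescent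

variable {R : Type*} [CommRing R] {M N : Type*} [AddCommGroup M] [Module R M] [AddCommGroup N] [Module R N]
  (σ : M →ₗ[R] M) (res : N →ₗ[R] M) (cor : M →ₗ[R] N)

/-! ## §1 `cor ∘ res = 2` and `2`-saturation of the fixed part -/

/-- **`cor (res y) = 2·y`**: from `res ∘ cor = 1 + σ`, `σ ∘ res = res` and injectivity of `res`
(`res (cor (res y)) = res y + σ (res y) = 2·res y = res (2·y)`). [cite: NeukirchSchmidtWingberg2008, Ch. I (1.5.7) (cor ∘ res = multiplication by the index; abstract shape)] -/
theorem cor_res_eq_two_smul (hres : Function.Injective res) (hσres : ∀ y, σ (res y) = res y)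
    (hrc : ∀ m, res (cor m) = m + σ m) (y : N) : cor (res y) = 2 • y := by
  apply hres
  rw [hrc, hσres, map_nsmul, two_nsmul]

/-- **The `σ`-fixed part is `2`-saturated when `M` has no `2`-torsion**: `σ (2·m) = 2·m ⇒ σ m = m`. [folklore] -/
theorem sigma_eq_self_of_two_smul (h2 : ∀ m : M, 2 • m = 0 → m = 0) {m : M} (hm : σ (2 • m) = 2 • m) :
    σ m = m := by
  have h : 2 • (σ m - m) = 0 := by rw [nsmul_sub, ← map_nsmul, hm, sub_self]
  exact sub_eq_zero.mp (h2 _ h)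

/-! ## §2 Theorem E / Theorem F (F1), abstract cores -/

/-- **Theorem E (abstract core): if `m + σ m = 2·w` then `cor m` is `2`-divisible downstairs.** `2·w = m + σ m = res (cor m)` is
`σ`-fixed (`σ ∘ res = res`), so `w` is (saturation, no `2`-torsion), so `w = res x` (`range res = M^σ`), and
`res (cor m) = 2·w = res (2·x)`, whence `cor m = 2·x` by injectivity. On a rectangular lattice Kato's classes satisfy the hypothesis:
`(1+σ) z̃_γ = z̃_{γ+ιγ} = z̃_{2δ} = 2·z̃_δ` (§3).
[cite: Kato2004Asterisque, Thm. 12.5 (1) (p. 221) and §13.9 (p. 230) (the relation between σ_{−1} z_γ and z_{ιγ}; shape only)] -/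
theorem exists_cor_eq_two_smul_of_add_sigma_eq_two_smul (hres : Function.Injective res)
    (hσres : ∀ y, σ (res y) = res y) (hfix : ∀ m, σ m = m → ∃ y, res y = m)
    (hrc : ∀ m, res (cor m) = m + σ m) (h2 : ∀ m : M, 2 • m = 0 → m = 0)
    {m w : M} (hw : m + σ m = 2 • w) : ∃ x : N, cor m = 2 • x := by
  have hfixed : σ (2 • w) = 2 • w := by rw [← hw, ← hrc, hσres]
  obtain ⟨x, hx⟩ := hfix w (sigma_eq_self_of_two_smul σ h2 hfixed)
  refine ⟨x, hres ?_⟩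
  rw [hrc, hw, ← hx, map_nsmul]

/-- **Theorem F (F1), abstract core — the canonical half class**: a `σ`-invariant class `z` upstairs descends to a UNIQUE `y′`
downstairs (`res y′ = z`). [cite: NeukirchSchmidtWingberg2008, Ch. I (1.6.7) (inflation–restriction; abstract shape)] -/
theorem existsUnique_res_eq_of_sigma_eq (hres : Function.Injective res) (hfix : ∀ m, σ m = m → ∃ y, res y = m)
    {z : M} (hz : σ z = z) : ∃! y : N, res y = z := by
  obtain ⟨y, hy⟩ := hfix z hz
  exact ⟨y, hy, fun y' hy' => hres (hy'.trans hy.symm)⟩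

/-- **… and its corestriction is TWICE the half class**: `res y′ = z ⇒ cor z = 2·y′`. [cite: NeukirchSchmidtWingberg2008, Ch. I (1.5.7) (abstract shape)] -/
theorem cor_eq_two_smul_of_res_eq (hres : Function.Injective res) (hσres : ∀ y, σ (res y) = res y)
    (hrc : ∀ m, res (cor m) = m + σ m) {z : M} {y : N} (hy : res y = z) : cor z = 2 • y := by
  rw [← hy]
  exact cor_res_eq_two_smul σ res cor hres hσres hrc y

/-- **A `σ`-invariant class is NOT `2`-divisible upstairs by a non-descending class**: if `z = 2·v` upstairs with `σ z = z` then `σ v = v`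
(saturation), so `v` descends too — the algebra behind Theorem F (F5) («an integral Euler system at half of Kato's» would halve `y′`).
[folklore] -/
theorem sigma_eq_self_of_eq_two_smul (h2 : ∀ m : M, 2 • m = 0 → m = 0) {z v : M} (hz : σ z = z) (hv : z = 2 • v) :
    σ v = v :=
  sigma_eq_self_of_two_smul σ h2 (by rw [← hv, hz])

/-! ## §3 The Kato-span form on a rectangular lattice -/

section KatoSpan

variable {T : Type*} [AddCommGroup T] (ι : T → T) (ζ : T →+ M)

/-- **On a rectangular lattice every class `z̃_γ` satisfies Theorem E's hypothesis**: if `σ (ζ γ) = ζ (ι γ)` for all `γ` (Kato 12.5 (1))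
and `γ + ι γ = 2·δ` (rectangular: `(1 ± ι)T = 2T^±`), then `ζ γ + σ (ζ γ) = 2·ζ δ`. [cite: Kato2004Asterisque, Thm. 12.5 (1) (p. 221) (shape only)] -/
theorem add_sigma_eq_two_smul_of_rectangular (hζ : ∀ γ, σ (ζ γ) = ζ (ι γ)) {γ δ : T} (hδ : γ + ι γ = 2 • δ) :
    ζ γ + σ (ζ γ) = 2 • ζ δ := by
  rw [hζ, ← map_add, hδ, map_nsmul]

/-- **Theorem E for the classes `z̃_γ` on a rectangular lattice**: `cor (ζ γ) ∈ 2N` for every `γ`.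
[cite: Kato2004Asterisque, Thm. 12.5 (1) (p. 221), Thm. 12.6 (p. 222) (shape only)] -/
theorem exists_cor_apply_eq_two_smul_of_rectangular (hres : Function.Injective res)
    (hσres : ∀ y, σ (res y) = res y) (hfix : ∀ m, σ m = m → ∃ y, res y = m)
    (hrc : ∀ m, res (cor m) = m + σ m) (h2 : ∀ m : M, 2 • m = 0 → m = 0)
    (hζ : ∀ γ, σ (ζ γ) = ζ (ι γ)) (hrect : ∀ γ, ∃ δ, γ + ι γ = 2 • δ) (γ : T) :
    ∃ x : N, cor (ζ γ) = 2 • x := by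
  obtain ⟨δ, hδ⟩ := hrect γ
  exact exists_cor_eq_two_smul_of_add_sigma_eq_two_smul σ res cor hres hσres hfix hrc h2
    (add_sigma_eq_two_smul_of_rectangular σ ι ζ hζ hδ)

/-- **Theorem E, Kato-span form: on a rectangular lattice EVERY element of the `R`-span of the classes `z̃_γ` has `2`-divisible
corestriction** (`R = Λ_U` acts compatibly: `res`, `cor` are `R`-linear). The triage's `closure_katoSpan_le_corTwoDivisible` in this
transcription. [cite: Kato2004Asterisque, Thm. 12.5 (1) (p. 221), Thm. 12.6 (p. 222) (shape only)] -/
theorem exists_cor_eq_two_smul_of_mem_span_of_rectangular (hres : Function.Injective res)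
    (hσres : ∀ y, σ (res y) = res y) (hfix : ∀ m, σ m = m → ∃ y, res y = m)
    (hrc : ∀ m, res (cor m) = m + σ m) (h2 : ∀ m : M, 2 • m = 0 → m = 0)
    (hζ : ∀ γ, σ (ζ γ) = ζ (ι γ)) (hrect : ∀ γ, ∃ δ, γ + ι γ = 2 • δ)
    {m : M} (hm : m ∈ Submodule.span R (Set.range ζ)) : ∃ x : N, cor m = 2 • x := by
  induction hm using Submodule.span_induction with
  | mem x hx =>
    obtain ⟨γ, rfl⟩ := hx
    exact exists_cor_apply_eq_two_smul_of_rectangular σ res cor ι ζ hres hσres hfix hrc h2 hζ hrect γ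
  | zero => exact ⟨0, by rw [map_zero, nsmul_zero]⟩
  | add x y _ _ hx hy =>
    obtain ⟨a, ha⟩ := hx
    obtain ⟨b, hb⟩ := hy
    exact ⟨a + b, by rw [map_add, ha, hb, nsmul_add]⟩
  | smul r x _ hx =>
    obtain ⟨a, ha⟩ := hx
    exact ⟨r • a, by rw [map_smul, ha, two_nsmul, two_nsmul, smul_add]⟩

end KatoSpan

end Summit.BirchSwinnertonDyer.BirchSwinnertonDyer.Theorems.SteinbergFibreAtTwo.HalfClassDescent
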